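import Summits.CriticalPhenomena.CardyFormulaZ2.Theorems.CardyBoundaryCoulombGasBoundaryDefectGaussianRS17ConfigsNonemptyPart11

/-!
# Stub `s17_eventually_configsNonempty` of the D2 completion (line
# `rainbow-monomials-in-excursion-kernels`, crux `BoundaryDefectGaussianR`,
# stmt-CriticalPhenomena-14132) — Part 12: away from the insertion points nearby prescribed cells
# carry one level (the silent case of the Lipschitz lemma)

Setting: `ι` admissible on `V`, `ds = cycle V d₀` from the sink's dart, `st t` the walk states,
`L = sinkLegs`; the insertion points FLAT at radius `sinkLegs + Rx` (`Rx ≥ 2`) and every boundary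
vertex of `V` carrying a half-plane / convex / reflex chart of sup-radius `N = 2 L + 8` (BIGCHART;
it restricts to the radius-`3` CHART of Part 34, `gl_chart3`).

* `gl_insertion_dart` — every insertion point is the vertex of a cycle dart (admissibility);
* `gl_face_visited` — a non-free face-cell whose doubled centre is within `2 L + 3` of the doubled
  vertex of a cycle dart IS the gap face of a cycle dart followed by a free stretch, at the level
  after it (its own exterior dart, `tc_exists_dart_of_face`, is a cycle dart by `lc_on_cycle`,
  Part 6; so the default level `0` never occurs near the walk);
* `gl_caseA` — if NO insertion point is within sup-distance `4 L + 6` of the vertex `u` of the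
  cycle dart `ds[s]`, then for every cycle dart `ds[t']` with vertex within `L + 2` of `u` the four
  states `st s`, `st (s+1)`, `st t'`, `st (t'+1)` carry one level: `t'` is within `2 L + 5` steps of
  `s` along the cycle (locality, Part 5) and all darts in between are silent (Part 8).
Part 13 combines this with the strip case (Part 11) into the Lipschitz property and the existence
of a configuration. Registered one-line form `s17_configsNonempty_part12` (= `gl_face_visited`).
All [folklore].
-/

namespace Summit.CriticalPhenomena.CardyFormulaZ2.Cruxes.BoundaryDefectGaussianR.RainbowMonomialsInExcursionKernels

open Literature.Probability.LatticeModels Literature.Probability.LatticeModels.CollarLegModel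

/-- BIGCHART restricts to CHART at radius `3`. [folklore] -/
theorem gl_chart3 {V : Finset (ℤ × ℤ)} {N : ℕ} (hN : 3 ≤ N)
    (hBC : ∀ u ∈ V, ∀ k : Fin 4, u + dir k ∉ V → ∃ (K : Fin 4) (c₁ c₂ : ℤ),
      (∀ v : ℤ × ℤ, |v.1 - u.1| ≤ N → |v.2 - u.2| ≤ N →
        (v ∈ V ↔ c₂ ≤ v.1 * (dir (K + 1)).1 + v.2 * (dir (K + 1)).2)) ∨
      (∀ v : ℤ × ℤ, |v.1 - u.1| ≤ N → |v.2 - u.2| ≤ N →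
        (v ∈ V ↔ c₁ ≤ v.1 * (dir K).1 + v.2 * (dir K).2 ∧
          c₂ ≤ v.1 * (dir (K + 1)).1 + v.2 * (dir (K + 1)).2)) ∨
      (∀ v : ℤ × ℤ, |v.1 - u.1| ≤ N → |v.2 - u.2| ≤ N →
        (v ∈ V ↔ c₂ ≤ v.1 * (dir (K + 1)).1 + v.2 * (dir (K + 1)).2 ∨
          v.1 * (dir K).1 + v.2 * (dir K).2 ≤ c₁))) :
    ∀ u ∈ V, ∀ k : Fin 4, u + dir k ∉ V → ∃ (K : Fin 4) (c₁ c₂ : ℤ),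
      (∀ v : ℤ × ℤ, |v.1 - u.1| ≤ 3 → |v.2 - u.2| ≤ 3 →
        (v ∈ V ↔ c₂ ≤ v.1 * (dir (K + 1)).1 + v.2 * (dir (K + 1)).2)) ∨
      (∀ v : ℤ × ℤ, |v.1 - u.1| ≤ 3 → |v.2 - u.2| ≤ 3 →
        (v ∈ V ↔ c₁ ≤ v.1 * (dir K).1 + v.2 * (dir K).2 ∧
          c₂ ≤ v.1 * (dir (K + 1)).1 + v.2 * (dir (K + 1)).2)) ∨
      (∀ v : ℤ × ℤ, |v.1 - u.1| ≤ 3 → |v.2 - u.2| ≤ 3 →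
        (v ∈ V ↔ c₂ ≤ v.1 * (dir (K + 1)).1 + v.2 * (dir (K + 1)).2 ∨
          v.1 * (dir K).1 + v.2 * (dir K).2 ≤ c₁)) := by
  intro u hu k hk
  have hNz : (3 : ℤ) ≤ N := by exact_mod_cast hN
  obtain ⟨K, c₁, c₂, h⟩ := hBC u hu k hk
  refine ⟨K, c₁, c₂, ?_⟩
  rcases h with h | h | h
  · exact Or.inl fun v h1 h2 => h v (h1.trans hNz) (h2.trans hNz)
  · exact Or.inr (Or.inl fun v h1 h2 => h v (h1.trans hNz) (h2.trans hNz))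
  · exact Or.inr (Or.inr fun v h1 h2 => h v (h1.trans hNz) (h2.trans hNz))

/-- A smaller flat radius follows from a larger one. [folklore] -/
theorem gl_flat_mono (ι : LegInsertionData) (V : Finset (ℤ × ℤ)) {R₁ R₂ : ℤ} (h12 : R₁ ≤ R₂) (h1 : 0 ≤ (ι.sinkLegs : ℤ) + R₁)
    (hflat : ∀ x ∈ insert ι.sink ι.source, ∃ dvec : ℤ × ℤ,
      (dvec = (1, 0) ∨ dvec = (-1, 0) ∨ dvec = (0, 1) ∨ dvec = (0, -1)) ∧
      ∀ v : ℤ × ℤ, (v.1 - x.1) ^ 2 + (v.2 - x.2) ^ 2 ≤ ((ι.sinkLegs : ℤ) + R₂) ^ 2 →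
        (v ∈ V ↔ 0 ≤ (v.1 - x.1) * dvec.1 + (v.2 - x.2) * dvec.2)) :
    ∀ x ∈ insert ι.sink ι.source, ∃ dvec : ℤ × ℤ,
      (dvec = (1, 0) ∨ dvec = (-1, 0) ∨ dvec = (0, 1) ∨ dvec = (0, -1)) ∧
      ∀ v : ℤ × ℤ, (v.1 - x.1) ^ 2 + (v.2 - x.2) ^ 2 ≤ ((ι.sinkLegs : ℤ) + R₁) ^ 2 →
        (v ∈ V ↔ 0 ≤ (v.1 - x.1) * dvec.1 + (v.2 - x.2) * dvec.2) := by
  intro x hx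
  obtain ⟨dvec, hd, hV⟩ := hflat x hx
  refine ⟨dvec, hd, fun v hv => hV v (le_trans hv ?_)⟩
  nlinarith

/-- The doubled centre of the gap face of a dart is within sup-distance `1` of its doubled vertex.
[folklore] -/
theorem gl_dist_gapFace (u : ℤ × ℤ) (k : Fin 4) :
    |2 * (gapFace (u, k)).1 + 1 - 2 * u.1| ≤ 1 ∧ |2 * (gapFace (u, k)).2 + 1 - 2 * u.2| ≤ 1 := by
  obtain ⟨a, b⟩ := u
  fin_cases k <;> simp [gapFace] <;> norm_num [abs_le] <;> omega

section Admissible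

variable (ι : LegInsertionData) (V : Finset (ℤ × ℤ)) {d₀ : Dart} (hadm : ι.IsAdmissible V)
  (h0 : outDart V ι.sink = some d₀) {st : ℕ → WalkState}
  (hst : ∀ t, st t = List.foldl (fun s d => s.step (ι.startAt V d)) ι.init ((cycle V d₀).take t))
  (hBC : ∀ u ∈ V, ∀ k : Fin 4, u + dir k ∉ V → ∃ (K : Fin 4) (c₁ c₂ : ℤ),
    (∀ v : ℤ × ℤ, |v.1 - u.1| ≤ ((2 * ι.sinkLegs + 8 : ℕ) : ℤ) → |v.2 - u.2| ≤ ((2 * ι.sinkLegs + 8 : ℕ) : ℤ) →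
      (v ∈ V ↔ c₂ ≤ v.1 * (dir (K + 1)).1 + v.2 * (dir (K + 1)).2)) ∨
    (∀ v : ℤ × ℤ, |v.1 - u.1| ≤ ((2 * ι.sinkLegs + 8 : ℕ) : ℤ) → |v.2 - u.2| ≤ ((2 * ι.sinkLegs + 8 : ℕ) : ℤ) →
      (v ∈ V ↔ c₁ ≤ v.1 * (dir K).1 + v.2 * (dir K).2 ∧
        c₂ ≤ v.1 * (dir (K + 1)).1 + v.2 * (dir (K + 1)).2)) ∨
    (∀ v : ℤ × ℤ, |v.1 - u.1| ≤ ((2 * ι.sinkLegs + 8 : ℕ) : ℤ) → |v.2 - u.2| ≤ ((2 * ι.sinkLegs + 8 : ℕ) : ℤ) →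
      (v ∈ V ↔ c₂ ≤ v.1 * (dir (K + 1)).1 + v.2 * (dir (K + 1)).2 ∨
        v.1 * (dir K).1 + v.2 * (dir K).2 ≤ c₁)))

include hadm h0 in
/-- **Every insertion point is the vertex of a cycle dart** (admissibility: it is met by the
walk). [folklore] -/
theorem gl_insertion_dart {x₀ : ℤ × ℤ} (hx₀ : x₀ ∈ insert ι.sink ι.source) :
    ∃ s₀, ∃ hs₀ : s₀ < (cycle V d₀).length, ((cycle V d₀)[s₀]).1 = x₀ := by
  obtain ⟨-, -, ⟨e, he, hex⟩⟩ := hadm.2.2.2.1 x₀ hx₀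
  obtain ⟨t, ht, rfl⟩ := (mem_walk_iff ι V h0).1 he
  exact ⟨t, ht, hex⟩

include hadm h0 hst hBC in
/-- **Near the walk every prescribed face is met by the walk.** A non-free face-cell whose doubled
centre is within sup-distance `2 L + 3` of the doubled vertex of a cycle dart `ds[s]` is the gap face
of a cycle dart followed by a free stretch, and carries the level after that dart. [folklore] -/
theorem gl_face_visited {s : ℕ} (hs : s < (cycle V d₀).length) {f : ℤ × ℤ}
    (hfc : f ∈ (ι.model V).faceCells) (hff : (f, true) ∉ (ι.model V).freeCells)
    (hnear : |2 * f.1 + 1 - 2 * ((cycle V d₀)[s]).1.1| ≤ 2 * ι.sinkLegs + 3 ∧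
      |2 * f.2 + 1 - 2 * ((cycle V d₀)[s]).1.2| ≤ 2 * ι.sinkLegs + 3) :
    ∃ t, ∃ ht : t < (cycle V d₀).length, gapFace (cycle V d₀)[t] = f ∧
      (st (t + 1)).wired = false ∧ (ι.model V).C.faceH f = (st (t + 1)).level := by
  obtain ⟨hv₀, ht₀⟩ := sinkDart_exterior ι V hadm h0
  have hext : ((cycle V d₀)[s]).1 ∈ V ∧ ((cycle V d₀)[s]).1 + dir ((cycle V d₀)[s]).2 ∉ V := by
    rw [se_cycle_getElem]
    exact (s3_dsucc_iterate V s).1 d₀ hv₀ ht₀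
  have hCH := gl_chart3 (by omega) hBC
  rcases pc_face_touch ι V hadm h0 hst hCH hff with h | ⟨-, hno⟩
  · exact h
  · exfalso
    -- the face's own exterior dart is a cycle dart near `ds[s]`
    obtain ⟨hni, -⟩ := not_mem_of_not_mem_freeCells (ι.model V) hff
    have hfV : f ∈ SixVertex.faces V := hfc
    obtain ⟨w, hwf, hwV⟩ := cb_exists_corner_not_mem hfV hni
    obtain ⟨j, hfj⟩ := mem_vertexFaces_iff_gapFace.1 (mem_vertexFaces_of_mem_faceCorners hwf)
    obtain ⟨v, hvV, hfv⟩ := Finset.mem_biUnion.1 hfV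
    obtain ⟨e, he, het, hge⟩ := tc_exists_dart_of_face hwV j
      ⟨v, hvV, by rw [← hfj]; exact se_mem_faceCorners_of_mem_vertexFaces hfv⟩
    rw [← hfj] at hge
    -- its vertex is a corner of `f`, hence near `ds[s]`
    have hec : e.1 ∈ SixVertex.faceCorners f := by
      rw [← hge]
      obtain ⟨eu, ek⟩ := e
      exact (mem_faceCorners_gapFace _ _ _).2 (Or.inl rfl)
    have hcc : (e.1.1 = f.1 ∨ e.1.1 = f.1 + 1) ∧ (e.1.2 = f.2 ∨ e.1.2 = f.2 + 1) := by
      simp only [SixVertex.faceCorners, Finset.mem_insert, Finset.mem_singleton] at hec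
      obtain ⟨a, b⟩ := f
      rcases hec with h | h | h | h <;> rw [h] <;> simp
    obtain ⟨c1, c2⟩ := hcc
    obtain ⟨n1, n2⟩ := hnear
    rw [abs_le] at n1 n2
    have hnear' : |e.1.1 - ((cycle V d₀)[s]).1.1| ≤ ((ι.sinkLegs + 2 : ℕ) : ℤ) ∧
        |e.1.2 - ((cycle V d₀)[s]).1.2| ≤ ((ι.sinkLegs + 2 : ℕ) : ℤ) := by
      push_cast
      constructor <;> rw [abs_le] <;> constructor <;> omega
    obtain ⟨s', hs', hds'⟩ := lc_on_cycle hv₀ ht₀ (Dm := ι.sinkLegs + 2) (N := 2 * ι.sinkLegs + 8)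
      (by omega) hs he het (hBC _ hext.1 _ hext.2) hnear'
    exact hno s' hs' (by rw [hds', hge])

include hadm h0 hst hBC in
/-- **The silent case.** With the insertion points flat at radius `sinkLegs + Rx` (`Rx ≥ 2`): if
no insertion point is within sup-distance `4 L + 6` of the vertex `u` of the cycle dart `ds[s]`,
then for every cycle dart `ds[t']` with vertex within `L + 2` of `u` the states `st s`, `st (s+1)`,
`st t'`, `st (t'+1)` carry one level. [folklore] -/
theorem gl_caseA {Rx : ℤ} (hRx : 2 ≤ Rx)
    (hflat : ∀ x ∈ insert ι.sink ι.source, ∃ dvec : ℤ × ℤ,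
      (dvec = (1, 0) ∨ dvec = (-1, 0) ∨ dvec = (0, 1) ∨ dvec = (0, -1)) ∧
      ∀ v : ℤ × ℤ, (v.1 - x.1) ^ 2 + (v.2 - x.2) ^ 2 ≤ ((ι.sinkLegs : ℤ) + Rx) ^ 2 →
        (v ∈ V ↔ 0 ≤ (v.1 - x.1) * dvec.1 + (v.2 - x.2) * dvec.2))
    {s : ℕ} (hs : s < (cycle V d₀).length)
    (hfar : ∀ x₀ ∈ insert ι.sink ι.source,
      4 * (ι.sinkLegs : ℤ) + 7 ≤ |((cycle V d₀)[s]).1.1 - x₀.1| ∨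
        4 * (ι.sinkLegs : ℤ) + 7 ≤ |((cycle V d₀)[s]).1.2 - x₀.2|)
    {t' : ℕ} (ht' : t' < (cycle V d₀).length)
    (hnear : |((cycle V d₀)[t']).1.1 - ((cycle V d₀)[s]).1.1| ≤ ((ι.sinkLegs + 2 : ℕ) : ℤ) ∧
      |((cycle V d₀)[t']).1.2 - ((cycle V d₀)[s]).1.2| ≤ ((ι.sinkLegs + 2 : ℕ) : ℤ)) :
    (st (s + 1)).level = (st s).level ∧ (st t').level = (st s).level ∧
      (st (t' + 1)).level = (st s).level := by
  obtain ⟨hv₀, ht₀⟩ := sinkDart_exterior ι V hadm h0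
  have hext : ((cycle V d₀)[s]).1 ∈ V ∧ ((cycle V d₀)[s]).1 + dir ((cycle V d₀)[s]).2 ∉ V := by
    rw [se_cycle_getElem]
    exact (s3_dsucc_iterate V s).1 d₀ hv₀ ht₀
  obtain ⟨m, hm, hloc⟩ := lc_locality hv₀ ht₀ (Dm := ι.sinkLegs + 2) (N := 2 * ι.sinkLegs + 8)
    (by omega) hs ht' (hBC _ hext.1 _ hext.2) hnear
  rcases hloc with hA | hB
  · -- `t'` after `s`
    have hfar' : ∀ x₀ ∈ insert ι.sink ι.source,
        (m : ℤ) + ι.sinkLegs ≤ |((cycle V d₀)[s]).1.1 - x₀.1| ∨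
          (m : ℤ) + ι.sinkLegs ≤ |((cycle V d₀)[s]).1.2 - x₀.2| := by
      intro x₀ hx₀
      rcases hfar x₀ hx₀ with h | h
      · left; omega
      · right; omega
    obtain ⟨⟨h1, -⟩, ⟨h2, -⟩, ⟨h3, -⟩⟩ := ca_levels_eq ι V hadm h0 hst hRx hflat hs m hfar' ht' hA
    exact ⟨h1, h2, h3⟩
  · -- `s` after `t'`
    have hfar' : ∀ x₀ ∈ insert ι.sink ι.source,
        (m : ℤ) + ι.sinkLegs ≤ |((cycle V d₀)[t']).1.1 - x₀.1| ∨
          (m : ℤ) + ι.sinkLegs ≤ |((cycle V d₀)[t']).1.2 - x₀.2| := by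
      intro x₀ hx₀
      obtain ⟨n1, n2⟩ := hnear
      rw [abs_le] at n1 n2
      push_cast at n1 n2
      rcases hfar x₀ hx₀ with h | h
      · left; rw [le_abs] at h ⊢; omega
      · right; rw [le_abs] at h ⊢; omega
    obtain ⟨⟨hA', -⟩, ⟨hB', -⟩, ⟨hC', -⟩⟩ := ca_levels_eq ι V hadm h0 hst hRx hflat ht' m hfar' hs hB
    exact ⟨hC'.trans hB'.symm, hB'.symm, hA'.trans hB'.symm⟩

end Admissible

/-! ### Registered one-line form -/

/-- **Registered sub-goal `s17_configsNonempty_part12`** of `s17_eventually_configsNonempty`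
(stmt-CriticalPhenomena-14132): for an admissible insertion on a `V` with BIGCHART (radius
`2 sinkLegs + 8`), a non-free face-cell whose doubled centre is within `2 sinkLegs + 3` of the
doubled vertex of a cycle dart is the gap face of a cycle dart followed by a free stretch, at the
level after it (one-line form of `gl_face_visited`). [folklore] -/
theorem s17_configsNonempty_part12 : ∀ (ι : Literature.Probability.LatticeModels.CollarLegModel.LegInsertionData) (V : Finset (ℤ × ℤ)) (d₀ : Literature.Probability.LatticeModels.CollarLegModel.Dart) (st : ℕ → Literature.Probability.LatticeModels.CollarLegModel.WalkState), ι.IsAdmissible V → Literature.Probability.LatticeModels.CollarLegModel.outDart V ι.sink = some d₀ → (∀ t, st t = List.foldl (fun s d ↦ s.step (ι.startAt V d)) ι.init ((Literature.Probability.LatticeModels.CollarLegModel.cycle V d₀).take t)) → (∀ u ∈ V, ∀ k : Fin 4, u + Literature.Probability.LatticeModels.CollarLegModel.dir k ∉ V → ∃ (K : Fin 4) (c₁ c₂ : ℤ), (∀ v : ℤ × ℤ, |v.1 - u.1| ≤ ((2 * ι.sinkLegs + 8 : ℕ) : ℤ) → |v.2 - u.2| ≤ ((2 * ι.sinkLegs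 + 8 : ℕ) : ℤ) → (v ∈ V ↔ c₂ ≤ v.1 * (Literature.Probability.LatticeModels.CollarLegModel.dir (K + 1)).1 + v.2 * (Literature.Probability.LatticeModels.CollarLegModel.dir (K + 1)).2)) ∨ (∀ v : ℤ × ℤ, |v.1 - u.1| ≤ ((2 * ι.sinkLegs + 8 : ℕ) : ℤ) → |v.2 - u.2| ≤ ((2 * ι.sinkLegs + 8 : ℕ) : ℤ) → (v ∈ V ↔ c₁ ≤ v.1 * (Literature.Probability.LatticeModels.CollarLegModel.dir K).1 + v.2 * (Literature.Probability.LatticeModels.CollarLegModel.dir K).2 ∧ c₂ ≤ v.1 * (Literature.Probability.LatticeModels.CollarLegModel.dir (K + 1)).1 + v.2 * (Literature.Probability.LatticeModels.CollarLegModel.dir (K + 1)).2)) ∨ (∀ v : ℤ × ℤ, |v.1 - u.1| ≤ ((2 * ι.sinkLegs + 8 : ℕ) : ℤ) → |v.2 - u.2| ≤ ((2 * ι.sinkLegs + 8 : ℕ) : ℤ) → (v ∈ V ↔ c₂ ≤ v.1 * (Literature.Probability.LatticeModels.CollarLegModel.dir (K + 1)).1 + v.2 * (Literature.Probability.LatticeModels.CollarLegModel.dir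 (K + 1)).2 ∨ v.1 * (Literature.Probability.LatticeModels.CollarLegModel.dir K).1 + v.2 * (Literature.Probability.LatticeModels.CollarLegModel.dir K).2 ≤ c₁))) → ∀ (s : ℕ) (hs : s < (Literature.Probability.LatticeModels.CollarLegModel.cycle V d₀).length) (f : ℤ × ℤ), f ∈ (Literature.Probability.LatticeModels.CollarLegModel.LegInsertionData.model ι V).faceCells → (f, true) ∉ (Literature.Probability.LatticeModels.CollarLegModel.LegInsertionData.model ι V).freeCells → |2 * f.1 + 1 - 2 * ((Literature.Probability.LatticeModels.CollarLegModel.cycle V d₀)[s]).1.1| ≤ 2 * ι.sinkLegs + 3 ∧ |2 * f.2 + 1 - 2 * ((Literature.Probability.LatticeModels.CollarLegModel.cycle V d₀)[s]).1.2| ≤ 2 * ι.sinkLegs + 3 → ∃ t, ∃ ht : t < (Literature.Probability.LatticeModels.CollarLegModel.cycle V d₀).length, Literature.Probability.LatticeModels.CollarLegModel.gapFace ((Literature.Probability.LatticeModels.CollarLegModel.cycle V d₀)[t]) = f ∧ (st (t + 1)).wired = false ∧ (Literature.Probability.LatticeModels.CollarLegModel.LegInsertionData.model ι V).C.faceH f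 = (st (t + 1)).level :=
  fun ι V _ _ hadm h0 hst hBC _ hs _ hfc hff hnear => gl_face_visited ι V hadm h0 hst hBC hs hfc hff hnear

end Summit.CriticalPhenomena.CardyFormulaZ2.Cruxes.BoundaryDefectGaussianR.RainbowMonomialsInExcursionKernels
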